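import Literature.Probability.RandomPlanarGeometry.SAWZdLateralClassWeightedCensus
import HarnessLib

/-!
# Second moments and spans in every dimension: `Σ_{ω ∈ SAW_n(ℤ^{d+1})} (ω(n)·e₀)²`, the mean-square displacement numerator `Σ_ω ‖ω(n)‖² = (d+1)·T_n(2d)`,
# and the total span of the bridges are INTEGER POLYNOMIALS IN `2d`

Topic `Literature/Probability/RandomPlanarGeometry` (instances of `SAWZdLateralClassWeightedCensus.lean`: `exists_int_polynomial_sum_filter_saws`, `dvd_sub_sum_filter_saws`;
uses `extend_mem_saws_iff`, `isBridge_extend_iff` (`…ZdCostPolynomial`), `isBridge_congr_zero` (`…ZdParity`), `latRelabel_apply_zero`).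

PRINTED CONTEXT (locators only). Madras–Slade (1993) §1.1 eq. (1.1.4) (the mean-square displacement `⟨|ω(n)|²⟩`), eq. (1.1.8) (the `1/d` expansion); Clisby–Liang–Slade (2007)
§3.3 (enumerations of `c_n` and `⟨R_n²⟩` in all dimensions); Graham (2010) §4. NOT IN PRINT (lane statements):

* ★★★ `exists_int_polynomial_sum_sq_height` — **`T_n(d) := Σ_{ω ∈ SAW_n(ℤ^{d+1})} (ω(n)·e₀)² = Q(2d)`, `Q ∈ ℤ[X]`, `deg ≤ n`, `Q(0) = T_n(0)`**; ★★ `dvd_sub_sum_sq_height`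
  (dimension congruence);
* ★★ `sum_sq_apply_eq_sum_sq_apply_zero` — axis symmetry `Σ_ω (ω(n)·e_a)² = Σ_ω (ω(n)·e₀)²` (transposition of coordinates);
* ★★★ `exists_int_polynomial_sum_normSq` — **`Σ_{ω ∈ SAW_n(ℤ^{d+1})} ‖ω(n)‖² = (d+1)·T(2d)` with `T ∈ ℤ[X]`**: the mean-square displacement of the `n`-step SAW in `ℤ^{d+1}`
  is `(d+1)·T(2d)/C_n(2d)`, a quotient of integer polynomials in the dimension (`c_n = C_n(2d)` by `SAWCountZdDimensionCongruence`);
* ★★★ `exists_int_polynomial_sum_bridge_span` — **`Σ_{ω ∈ bridges_n(ℤ^{d+1})} span(ω) = Q(2d)`, `Q ∈ ℤ[X]`**, `Q(0) = n` (the straight bridge of the line).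
[cite: MadrasSlade1993, §1.1 eq. (1.1.4), eq. (1.1.8) p. 5; Definition 1.2.4] [cite: ClisbyLiangSlade2007, §3.3] [cite: Graham2010, Section 4]

Provenance: lane «pcv-sawmu», a-p3 g25 (2026-08-28). PURE STD, no data, no definitions.
-/

noncomputable section

open Finset
open scoped BigOperators
open Literature.Probability.LatticeModels
open Literature.Probability.RandomPlanarGeometry.SAW

namespace Literature.Probability.RandomPlanarGeometry.SAW.Zd

/-! ## §19 Second moments: `Σ_ω (ω(n)·e₀)²`, `Σ_ω ‖ω(n)‖²` over `SAW_n(ℤ^{d+1})`, and `Σ span` over bridges, as integer polynomials in `2d` -/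

section Moments

/-- The zero-extension along a lateral injection fixing `0` preserves the force coordinate. [folklore] -/
private theorem mext_apply_zero {u d : ℕ} {e : Fin (u + 1) → Fin (d + 1)} (he : Function.Injective e) (he0 : e 0 = 0)
    (x : Site (u + 1)) : Function.extend e x (0 : Fin (d + 1) → ℤ) 0 = x 0 := by
  rw [← he0, he.extend_apply]

/-- ★★★ **`T_n(d) := Σ_{ω ∈ SAW_n(ℤ^{d+1})} (ω(n)·e₀)²` IS AN INTEGER POLYNOMIAL IN `2d`**: there is `Q ∈ ℤ[X]`, `deg ≤ n`, `Q(0) = T_n(0)` (`= 2n²` on the line for `n ≥ 1`),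
with `T_n(d) = Q(2d)` for every `d` — the weighted lateral census with the invariant weight `(ω(n)·e₀)²`. [cite: MadrasSlade1993, §1.1 eq. (1.1.8) p. 5; §1.1 (mean-square
displacement)] [cite: Graham2010, Section 4] -/
theorem exists_int_polynomial_sum_sq_height (n : ℕ) :
    ∃ Q : Polynomial ℤ, Q.natDegree ≤ n ∧ Q.coeff 0 = ∑ ω ∈ saws 1 n, (ω n 0) ^ 2 ∧
      ∀ d : ℕ, ∑ ω ∈ saws (d + 1) n, (ω n 0) ^ 2 = Q.eval (2 * (d : ℤ)) := by
  classical
  obtain ⟨Q, hQ, hQ0, hev⟩ := exists_int_polynomial_sum_filter_saws (n := n) (fun _ _ => True) (fun D Ω => (Ω n 0) ^ 2)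
    (fun _ _ _ => Iff.rfl) (fun he he0 ω => by simp only [mext_apply_zero he he0])
    (fun _ _ _ _ => Iff.rfl) (fun u g ω => by simp only [latRelabel_apply_zero])
  refine ⟨Q, hQ, ?_, fun d => ?_⟩
  · rw [hQ0, Finset.sum_filter]
    exact Finset.sum_congr rfl fun _ _ => by simp
  · rw [← hev d, Finset.sum_filter]
    exact Finset.sum_congr rfl fun _ _ => by simp

/-- ★★ DIMENSION CONGRUENCE FOR `T_n`: `4·d·d′·(d − d′) ∣ d′(T_n(d) − T_n(0)) − d(T_n(d′) − T_n(0))`. [cite: MadrasSlade1993, §1.1 eq. (1.1.8) p. 5] -/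
theorem dvd_sub_sum_sq_height (n d d' : ℕ) :
    (4 * (d : ℤ) * d' * ((d : ℤ) - d')) ∣
      (d' : ℤ) * (∑ ω ∈ saws (d + 1) n, (ω n 0) ^ 2 - ∑ ω ∈ saws 1 n, (ω n 0) ^ 2) -
      (d : ℤ) * (∑ ω ∈ saws (d' + 1) n, (ω n 0) ^ 2 - ∑ ω ∈ saws 1 n, (ω n 0) ^ 2) := by
  classical
  have h := dvd_sub_sum_filter_saws (n := n) (fun _ _ => True) (fun D Ω => (Ω n 0) ^ 2)
    (fun _ _ _ => Iff.rfl) (fun he he0 ω => by simp only [mext_apply_zero he he0])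
    (fun _ _ _ _ => Iff.rfl) (fun u g ω => by simp only [latRelabel_apply_zero]) d d'
  simpa [Finset.sum_filter] using h

/-- The zero-extension along the transposition `(0 a)` is pre-composition with it. [folklore] -/
private theorem extend_swap_apply {d : ℕ} (a : Fin (d + 1)) (x : Site (d + 1)) (y : Fin (d + 1)) :
    Function.extend (Equiv.swap 0 a) x (0 : Fin (d + 1) → ℤ) y = x (Equiv.swap 0 a y) := by
  have h : y = Equiv.swap 0 a (Equiv.swap 0 a y) := by rw [Equiv.swap_apply_self]
  conv_lhs => rw [h]
  exact (Equiv.swap 0 a).injective.extend_apply _ _ _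

/-- ★★ AXIS SYMMETRY OF THE SECOND MOMENT: `Σ_{ω ∈ SAW_n(ℤ^{d+1})} (ω(n)·e_a)² = Σ_ω (ω(n)·e₀)²` for every coordinate `a` (transposition of the axes `0` and `a`).
[cite: MadrasSlade1993, §1.1 (lattice symmetry)] -/
theorem sum_sq_apply_eq_sum_sq_apply_zero (n d : ℕ) (a : Fin (d + 1)) :
    ∑ ω ∈ saws (d + 1) n, (ω n a) ^ 2 = ∑ ω ∈ saws (d + 1) n, (ω n 0) ^ 2 := by
  classical
  have he : Function.Injective (Equiv.swap (0 : Fin (d + 1)) a) := (Equiv.swap (0 : Fin (d + 1)) a).injective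
  refine Finset.sum_nbij' (fun (ω : ℕ → Site (d + 1)) (k : ℕ) => Function.extend (Equiv.swap (0 : Fin (d + 1)) a) (ω k) (0 : Fin (d + 1) → ℤ))
    (fun (ω : ℕ → Site (d + 1)) (k : ℕ) => Function.extend (Equiv.swap (0 : Fin (d + 1)) a) (ω k) (0 : Fin (d + 1) → ℤ)) ?_ ?_ ?_ ?_ ?_
  · intro ω hω; exact (extend_mem_saws_iff he ω).2 hω
  · intro ω hω; exact (extend_mem_saws_iff he ω).2 hω
  · intro ω _
    funext k y
    show Function.extend (Equiv.swap (0 : Fin (d + 1)) a) (Function.extend (Equiv.swap (0 : Fin (d + 1)) a) (ω k) (0 : Fin (d + 1) → ℤ))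
      (0 : Fin (d + 1) → ℤ) y = ω k y
    rw [extend_swap_apply, extend_swap_apply, Equiv.swap_apply_self]
  · intro ω _
    funext k y
    show Function.extend (Equiv.swap (0 : Fin (d + 1)) a) (Function.extend (Equiv.swap (0 : Fin (d + 1)) a) (ω k) (0 : Fin (d + 1) → ℤ))
      (0 : Fin (d + 1) → ℤ) y = ω k y
    rw [extend_swap_apply, extend_swap_apply, Equiv.swap_apply_self]
  · intro ω _
    show (ω n a) ^ 2 = (Function.extend (Equiv.swap (0 : Fin (d + 1)) a) (ω n) (0 : Fin (d + 1) → ℤ) 0) ^ 2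
    rw [extend_swap_apply, Equiv.swap_apply_left]

/-- ★★★ **THE MEAN-SQUARE DISPLACEMENT NUMERATOR `s_n(ℤ^{d+1}) := Σ_{ω ∈ SAW_n(ℤ^{d+1})} ‖ω(n)‖² = (d+1)·T_n(2d)` with `T_n ∈ ℤ[X]`** — so
`⟨‖ω(n)‖²⟩ = (d+1)·T_n(2d)/c_n(ℤ^{d+1})` is a quotient of integer polynomials in the dimension. [cite: MadrasSlade1993, §1.1 (mean-square displacement, eq. (1.1.4))]
[cite: ClisbyLiangSlade2007, §3.3] [cite: Graham2010, Section 4] -/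
theorem exists_int_polynomial_sum_normSq (n : ℕ) :
    ∃ Q : Polynomial ℤ, Q.natDegree ≤ n ∧
      ∀ d : ℕ, ∑ ω ∈ saws (d + 1) n, ∑ a : Fin (d + 1), (ω n a) ^ 2 = ((d : ℤ) + 1) * Q.eval (2 * (d : ℤ)) := by
  obtain ⟨Q, hQ, -, hev⟩ := exists_int_polynomial_sum_sq_height n
  refine ⟨Q, hQ, fun d => ?_⟩
  rw [Finset.sum_comm, Finset.sum_congr rfl fun a _ => sum_sq_apply_eq_sum_sq_apply_zero n d a, Finset.sum_const, Finset.card_univ,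
    Fintype.card_fin, nsmul_eq_mul, hev d]
  push_cast
  ring

/-- ★★★ **THE TOTAL SPAN OF THE BRIDGES, `Σ_{ω ∈ bridges_n(ℤ^{d+1})} span(ω)`, IS AN INTEGER POLYNOMIAL IN `2d`** (constant term `n`, the straight bridge of the line);
hence the mean span of an `n`-step bridge is a quotient of integer polynomials in `2d`. [cite: MadrasSlade1993, Definition 1.2.4; §1.1 eq. (1.1.8) p. 5] [cite: Graham2010, Section 4] -/
theorem exists_int_polynomial_sum_bridge_span (n : ℕ) :
    ∃ Q : Polynomial ℤ, Q.natDegree ≤ n ∧ Q.coeff 0 = ∑ ω ∈ bridges 1 n, ω n 0 ∧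
      ∀ d : ℕ, ∑ ω ∈ bridges (d + 1) n, ω n 0 = Q.eval (2 * (d : ℤ)) := by
  classical
  obtain ⟨Q, hQ, hQ0, hev⟩ := exists_int_polynomial_sum_filter_saws (n := n) (fun D Ω => IsBridge n Ω) (fun D Ω => Ω n 0)
    (fun he he0 ω => isBridge_extend_iff he he0 ω) (fun he he0 ω => by simp only [mext_apply_zero he he0])
    (fun u g ω _ => isBridge_congr_zero fun i => latRelabel_apply_zero g (ω i)) (fun u g ω => by simp only [latRelabel_apply_zero])
  refine ⟨Q, hQ, ?_, fun d => ?_⟩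
  · rw [hQ0, bridges]
  · rw [← hev d, bridges]

end Moments

end Literature.Probability.RandomPlanarGeometry.SAW.Zd

end
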